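import Literature.Computability.QuantumComplexity.SamplingChebyshev
import Literature.Computability.QuantumComplexity.StabilizerSimulation
import Literature.Computability.Cryptography.QuantumCircuitProofs
import Literature.Computability.Complexity.ProbabilisticClassesProofs
import Mathlib.NumberTheory.Real.Irrational
import Mathlib.Data.Nat.Size
import HarnessLib

/-!
# The Bravyi–Gosset estimator as a function of the coins, and its `3/4` guarantee

Topic `Literature/Computability/QuantumComplexity`, sub-namespace `BravyiGosset`, sixth file
towards `BravyiGosset2016_estimateAcceptProb_holds` (`StabilizerSimulation.lean`).

This file assembles the mathematics of the preceding files into the randomized algorithm of the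
named fact — as a pure function `estimate i r` of the instance and the coin string, which is
exactly what the polynomial-time-per-round machine of the sequel computes — and proves its
probabilistic guarantee:

* per sample block `β`: the `2^{⌈t/2⌉}` terms are run through by binary counting (`termStep`,
  `sampleEO`), accumulating `Σ_a ω^{|a|} Γ(a, β) = E + ω O` with Gaussian integers `E, O`
  (`toComplex_sampleEO`); `|E + ωO|² = u + v√2` with the integers `u = N(E) + N(O)`,
  `v = Re(Ē O) − Im(Ē O)` (`normSq_eq_uOf_add_vOf`), and by the key identity and the path-sum
  theorem `u + v√2 = 2^h 4^{1+⌈t/2⌉} |T_β(Φ)|²`, `Φ(z) = [z₀ = 1] ⟨z|U|x 0^m⟩` (`uv_sampleEO_eq`);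
* `finalize` — from the totals `U, V` over `L = 16 (q+1)²` samples, the output: `0` if `U = V = 0`,
  else the dyadic `(2c+1)/2^{K+1}` with `|c − 2^K ξ| ≤ 2`, `ξ = (U + V√2)/(L 2^h 4^{1+⌈t/2⌉})`,
  computed with `Nat.sqrt` at a data-dependent precision `K` (`finalize_close`:
  `|p̂ − ξ| ≤ ξ / (4(q+1))`);
* `estimate`, `coinLen`, `randAlg`, and the guarantee **`pr_goodEstimates_ge`**: for every
  oracle-free instance, `3/4 ≤ Pr_r[estimate i r ∈ goodEstimates i]` (moments from
  `EquatorialMoments.lean`, Chebyshev from `SamplingChebyshev.lean`, the case `P = 0` exactly by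
  the irrationality of `√2`).

## References

* S. Bravyi, D. Gosset, *Improved classical simulation of quantum circuits dominated by Clifford
  gates*, Phys. Rev. Lett. 116 (2016) 250501, arXiv:1601.07601v3: p. 2 eq. (2) (the claim), §II
  eq. (9)–(17) (the algorithm: gadgetization, `χ`-term decomposition, norm estimation with
  `L = 4ε⁻²` samples, success probability `3/4`).
-/

noncomputable section

namespace Literature.Computability.QuantumComplexity.BravyiGosset

open Complex Finset _root_.Computability Literature.Computability.Complexity
  Literature.Computability.Cryptography Matrix

/-! ### Small helpers -/

/-- A list sum over `List.range` is the `Finset.range` sum. [folklore] -/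
theorem list_sum_map_range {M : Type*} [AddCommMonoid M] (f : ℕ → M) (n : ℕ) :
    ((List.range n).map f).sum = ∑ a ∈ range n, f a := by
  induction n with
  | zero => simp
  | succ n ih => rw [List.range_succ, List.map_append, List.sum_append, ih, Finset.sum_range_succ]; simp

/-- `ω^m = ω^{m mod 2} · i^{⌊m/2⌋}`. [folklore] -/
theorem omega_pow_eq_mod_two (m : ℕ) : omega ^ m = omega ^ (m % 2) * I ^ (m / 2) := by
  conv_lhs => rw [← Nat.mod_add_div m 2, pow_add, pow_mul, omega_pow_two]

/-! ### One sample: running through the terms by binary counting -/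

/-- The number of `1`s among the first `n` binary digits of `a` (`|a|` for the term index `a`).
[folklore] -/
def popN (n a : ℕ) : ℕ := ∑ p ∈ range n, Bool.toNat (Nat.testBit a p)

/-- **One term.** Add `ω^{|a|} Γ(a, β) = i^{⌊|a|/2⌋} ω^{|a| mod 2} Γ(a, β)` to the even accumulator
`E` or to the odd accumulator `O`. [cite: BravyiGosset2016, §II eq. (12)–(13)] -/
def termStep (N h : ℕ) (β : ℕ → Bool) (σ : SymState) (EO : GaussianInt × GaussianInt) (a : ℕ) :
    GaussianInt × GaussianInt :=
  let m := popN σ.numA a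
  let c := iPowZi (m / 2) * GData.gaussEval (SymState.numV h σ) (SymState.buildData N h β (Nat.testBit a) σ)
  if m % 2 = 0 then (EO.1 + c, EO.2) else (EO.1, EO.2 + c)

/-- **One sample**: the accumulators `(E, O)` after all `2^{⌈t/2⌉}` terms.
[cite: BravyiGosset2016, §II eq. (12)–(13)] -/
def sampleEO (N h : ℕ) (β : ℕ → Bool) (σ : SymState) : GaussianInt × GaussianInt :=
  (List.range (2 ^ σ.numA)).foldl (termStep N h β σ) (0, 0)

/-- The integer `u = N(E) + N(O)` of a sample. [folklore] -/
def uOf (EO : GaussianInt × GaussianInt) : ℤ := EO.1.norm + EO.2.norm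

/-- The integer `v = Re(Ē O) − Im(Ē O)` of a sample. [folklore] -/
def vOf (EO : GaussianInt × GaussianInt) : ℤ := (star EO.1 * EO.2).re - (star EO.1 * EO.2).im

/-- `ω = (1 + i) · (√2/2)`. [folklore] -/
theorem omega_eq' : omega = (1 + I) * ((Real.sqrt 2 / 2 : ℝ) : ℂ) := by
  rw [omega_eq_sqrt]; push_cast; ring

/-- **`|E + ωO|² = u + v√2`.** [folklore] -/
theorem normSq_eq_uOf_add_vOf (EO : GaussianInt × GaussianInt) :
    Complex.normSq ((EO.1 : ℂ) + omega * (EO.2 : ℂ)) = (uOf EO : ℝ) + (vOf EO : ℝ) * Real.sqrt 2 := by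
  obtain ⟨⟨a, b⟩, ⟨c, d⟩⟩ := EO
  unfold uOf vOf
  simp only [Zsqrtd.norm_def, Zsqrtd.star_mk, Zsqrtd.re_mul, Zsqrtd.im_mul,
    GaussianInt.toComplex_def', omega_eq']
  rw [Complex.normSq_apply]
  simp only [Complex.add_re, Complex.add_im, Complex.mul_re, Complex.mul_im, Complex.ofReal_re,
    Complex.ofReal_im, Complex.I_re, Complex.I_im, Complex.intCast_re, Complex.intCast_im,
    Complex.one_re, Complex.one_im]
  push_cast
  have h2 : Real.sqrt 2 * Real.sqrt 2 = 2 := Real.mul_self_sqrt (by norm_num)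
  linear_combination (((c : ℝ) ^ 2 + (d : ℝ) ^ 2) / 2) * h2

/-- `E + ωO = Σ_{a < 2^n} ω^{|a|} Γ(a, β)` for the fold over the term indices. [folklore] -/
theorem toComplex_sampleEO (N h : ℕ) (β : ℕ → Bool) (σ : SymState) :
    ((sampleEO N h β σ).1 : ℂ) + omega * ((sampleEO N h β σ).2 : ℂ) =
      ∑ a ∈ range (2 ^ σ.numA), omega ^ popN σ.numA a *
        GData.gsum (SymState.numV h σ) (SymState.buildData N h β (Nat.testBit a) σ) := by
  unfold sampleEO
  rw [← list_sum_map_range]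
  suffices key : ∀ (l : List ℕ) (EO : GaussianInt × GaussianInt),
      (((l.foldl (termStep N h β σ) EO).1 : ℂ) + omega * ((l.foldl (termStep N h β σ) EO).2 : ℂ)) =
        ((EO.1 : ℂ) + omega * (EO.2 : ℂ)) + (l.map fun a => omega ^ popN σ.numA a *
          GData.gsum (SymState.numV h σ) (SymState.buildData N h β (Nat.testBit a) σ)).sum by
    rw [key]; simp [GaussianInt.toComplex_zero]
  intro l
  induction l with
  | nil => intro EO; simp
  | cons a l ih =>
    intro EO
    rw [List.foldl_cons, ih, List.map_cons, List.sum_cons, ← add_assoc]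
    congr 1
    unfold termStep
    simp only
    rw [omega_pow_eq_mod_two (popN σ.numA a), ← GData.toComplex_gaussEval, ← toComplex_iPowZi]
    split
    · rename_i hm
      simp only [GaussianInt.toComplex_add, GaussianInt.toComplex_mul, hm, pow_zero, one_mul]
      ring
    · rename_i hm
      have hm1 : popN σ.numA a % 2 = 1 := by omega
      simp only [GaussianInt.toComplex_add, GaussianInt.toComplex_mul, hm1, pow_one]
      ring

/-! ### The term data depend only on the first `n` index bits -/

namespace SymState

/-- `augA` reads the bits `a p`, `p < ⌈t/2⌉`, only. [folklore] -/
theorem augA_congr (h : ℕ) (σ : SymState) {a a' : ℕ → Bool} (ha : ∀ p, p < σ.numA → a p = a' p) (D : GData) :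
    augA h σ a D = augA h σ a' D := by
  unfold augA
  suffices key : ∀ l : List ℕ, (∀ p ∈ l, p < σ.numA) → ∀ D, l.foldl (pairStep h σ a) D = l.foldl (pairStep h σ a') D from
    key _ (fun p hp => List.mem_range.1 hp) D
  intro l hl
  induction l with
  | nil => intro D; rfl
  | cons p l ih =>
    intro D
    rw [List.foldl_cons, List.foldl_cons]
    have hp : pairStep h σ a D p = pairStep h σ a' D p := by
      unfold pairStep; rw [ha p (hl p (by simp))]
    rw [hp]
    exact ih (fun p' hp' => hl p' (by simp [hp'])) _

/-- `buildData` reads the bits `a p`, `p < ⌈t/2⌉`, only. [folklore] -/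
theorem buildData_congr (N h : ℕ) (β : ℕ → Bool) (σ : SymState) {a a' : ℕ → Bool}
    (ha : ∀ p, p < σ.numA → a p = a' p) : buildData N h β a σ = buildData N h β a' σ := by
  unfold buildData; rw [augA_congr h σ ha]

end SymState

/-- `|a|` depends on the first `n` bits only, through any reader. [folklore] -/
theorem popN_eq_sum_of_agree (n a : ℕ) (f : ℕ → Bool) (hf : ∀ p, p < n → Nat.testBit a p = f p) :
    popN n a = ∑ p ∈ range n, Bool.toNat (f p) :=
  Finset.sum_congr rfl fun p hp => by rw [hf p (Finset.mem_range.1 hp)]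

/-- **The sample sum over the cube.** `E + ωO = Σ_{v ∈ 𝔽₂^n} ω^{|v|} Γ(v, β)`.
[cite: BravyiGosset2016, §II eq. (12)–(13)] -/
theorem toComplex_sampleEO_eq_sum_cube (N h : ℕ) (β : ℕ → Bool) (σ : SymState) :
    ((sampleEO N h β σ).1 : ℂ) + omega * ((sampleEO N h β σ).2 : ℂ) =
      ∑ v : Fin σ.numA → Bool, omega ^ (∑ p ∈ range σ.numA, Bool.toNat (wbit v p)) *
        GData.gsum (SymState.numV h σ) (SymState.buildData N h β (wbit v) σ) := by
  rw [toComplex_sampleEO]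
  have := sum_range_two_pow_eq_sum_testBit σ.numA
    (fun f => omega ^ (∑ p ∈ range σ.numA, Bool.toNat (f p)) *
      GData.gsum (SymState.numV h σ) (SymState.buildData N h β f σ))
    (fun f g hfg => by
      rw [Finset.sum_congr rfl fun p hp => by rw [hfg p (Finset.mem_range.1 hp)],
        SymState.buildData_congr N h β σ hfg])
  refine Eq.trans (Finset.sum_congr rfl fun a _ => ?_) this
  rfl

/-! ### The value of one sample against the amplitudes -/

/-- **One sample in terms of the test sum.** For an oracle-free gate list on `N ≥ 1` wires, its
final symbolic state `σ`, and a sample block `β`: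
`(1/√2)^h (E + ωO) = 2^{1+⌈t/2⌉} · T_β(Φ)`, `Φ(z) = [z₀] ⟨z|U|y⟩`.
[cite: BravyiGosset2016, §II eq. (13)–(15)] -/
theorem invSqrt2_pow_mul_sampleEO {N : ℕ} (hN : 0 < N) (gs : List (QGate cliffordT N))
    (hgs : ∀ g ∈ gs, g.IsOracleFree) (y : QReg N) (β : Fin (blockLen N) → Bool) :
    let σ := SymState.execGates gs (SymState.init y)
    invSqrt2 ^ hCount gs * (((sampleEO N σ.nv (wbit β) σ).1 : ℂ) + omega * ((sampleEO N σ.nv (wbit β) σ).2 : ℂ)) =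
      2 ^ (σ.numA + 1) * testSum (fun z => if z ⟨0, hN⟩ then (prodZeta omega gs *ᵥ basisState y) z else 0) β := by
  intro σ
  rw [toComplex_sampleEO_eq_sum_cube,
    SymState.sum_omega_pow_mul_gsum_buildData_eq_amplitudes hN gs hgs y (wbit β)]
  unfold testSum cc
  congr 1
  exact Finset.sum_congr rfl fun z _ => by by_cases hz : z ⟨0, hN⟩ = true <;> simp [hz]

/-- **The integers of one sample**: `u + v√2 = 2^h 4^{1+⌈t/2⌉} |T_β(Φ)|²`.
[cite: BravyiGosset2016, §II eq. (15)] -/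
theorem uv_sampleEO_eq {N : ℕ} (hN : 0 < N) (gs : List (QGate cliffordT N))
    (hgs : ∀ g ∈ gs, g.IsOracleFree) (y : QReg N) (β : Fin (blockLen N) → Bool) :
    let σ := SymState.execGates gs (SymState.init y)
    (uOf (sampleEO N σ.nv (wbit β) σ) : ℝ) + (vOf (sampleEO N σ.nv (wbit β) σ) : ℝ) * Real.sqrt 2 =
      2 ^ hCount gs * 4 ^ (σ.numA + 1) *
        Complex.normSq (testSum (fun z => if z ⟨0, hN⟩ then (prodZeta omega gs *ᵥ basisState y) z else 0) β) := by
  intro σ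
  have h := invSqrt2_pow_mul_sampleEO hN gs hgs y β
  rw [← normSq_eq_uOf_add_vOf]
  have h2 := congrArg Complex.normSq h
  rw [Complex.normSq_mul, Complex.normSq_mul, map_pow, map_pow] at h2
  have hinv : Complex.normSq invSqrt2 = 1 / 2 := by
    rw [Complex.normSq_eq_norm_sq]
    simp only [invSqrt2, norm_div, norm_one, Complex.norm_real, Real.norm_eq_abs,
      abs_of_nonneg (Real.sqrt_nonneg 2)]
    rw [div_pow, one_pow, Real.sq_sqrt (by norm_num)]
  have htwo : Complex.normSq 2 = 4 := by norm_num [Complex.normSq_apply]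
  rw [hinv, htwo] at h2
  have hpos : (0 : ℝ) < (1 / 2) ^ hCount gs := by positivity
  have key : Complex.normSq (((sampleEO N σ.nv (wbit β) σ).1 : ℂ) + omega * ((sampleEO N σ.nv (wbit β) σ).2 : ℂ)) =
      2 ^ hCount gs * (4 ^ (σ.numA + 1) *
        Complex.normSq (testSum (fun z => if z ⟨0, hN⟩ then (prodZeta omega gs *ᵥ basisState y) z else 0) β)) := by
    have h3 : (2 : ℝ) ^ hCount gs * (1 / 2) ^ hCount gs = 1 := by
      rw [← mul_pow]; norm_num
    calc _ = 2 ^ hCount gs * ((1 / 2) ^ hCount gs * Complex.normSq (((sampleEO N σ.nv (wbit β) σ).1 : ℂ) +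
          omega * ((sampleEO N σ.nv (wbit β) σ).2 : ℂ))) := by rw [← mul_assoc, h3, one_mul]
      _ = _ := by rw [h2]
  rw [key]; ring

/-! ### When the two real parts vanish -/

/-- `U + V√2 = 0` with integers forces `U = V = 0` (`√2` is irrational). [folklore] -/
theorem eq_zero_of_add_mul_sqrt_two_eq_zero {U V : ℤ} (h : (U : ℝ) + V * Real.sqrt 2 = 0) : U = 0 ∧ V = 0 := by
  by_cases hV : V = 0
  · subst hV
    simp only [Int.cast_zero, zero_mul, add_zero, Int.cast_eq_zero] at h
    exact ⟨h, rfl⟩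
  · exfalso
    have hirr := irrational_sqrt_two
    have : Real.sqrt 2 = ((-U : ℤ) : ℝ) / ((V : ℤ) : ℝ) := by
      have hV' : ((V : ℤ) : ℝ) ≠ 0 := by exact_mod_cast hV
      field_simp
      push_cast
      linarith
    exact hirr.ne_rat ((-U : ℚ) / V) (by rw [this]; push_cast; rfl)

/-- `U + V√2 > 0` with integers is at least `1/(|U| + 2|V|)`. [folklore] -/
theorem inv_le_add_mul_sqrt_two {U V : ℤ} (h : 0 < (U : ℝ) + V * Real.sqrt 2) :
    1 / (|(U : ℝ)| + 2 * |(V : ℝ)|) ≤ (U : ℝ) + V * Real.sqrt 2 := by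
  have hsq : Real.sqrt 2 * Real.sqrt 2 = 2 := Real.mul_self_sqrt (by norm_num)
  have hs2 : Real.sqrt 2 < 2 := by
    rw [show (2 : ℝ) = Real.sqrt 4 by rw [show (4:ℝ) = 2^2 by norm_num, Real.sqrt_sq (by norm_num)]]
    exact Real.sqrt_lt_sqrt (by norm_num) (by norm_num)
  have hs0 : 0 < Real.sqrt 2 := Real.sqrt_pos.2 (by norm_num)
  -- `Δ = U² − 2V²` is a nonzero integer
  have hΔint : U ^ 2 - 2 * V ^ 2 ≠ 0 := by
    intro hzero
    have hzr : (U : ℝ) ^ 2 - 2 * (V : ℝ) ^ 2 = 0 := by exact_mod_cast hzero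
    have hfac : ((U : ℝ) + V * Real.sqrt 2) * ((U : ℝ) - V * Real.sqrt 2) = 0 := by nlinarith [hsq]
    rcases mul_eq_zero.1 hfac with h1 | h1
    · linarith
    · obtain ⟨hU, hV⟩ := eq_zero_of_add_mul_sqrt_two_eq_zero (U := U) (V := -V) (by push_cast; linarith)
      have hV0 : V = 0 := by omega
      subst hU; subst hV0
      simp at h
  have hΔ1 : (1 : ℝ) ≤ |(U : ℝ) ^ 2 - 2 * (V : ℝ) ^ 2| := by
    have hc : ((U ^ 2 - 2 * V ^ 2 : ℤ) : ℝ) = (U : ℝ) ^ 2 - 2 * (V : ℝ) ^ 2 := by push_cast; ring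
    rw [← hc, ← Int.cast_abs, ← Int.cast_one, Int.cast_le]
    exact Int.one_le_abs hΔint
  have hB : |(U : ℝ) - V * Real.sqrt 2| ≤ |(U : ℝ)| + 2 * |(V : ℝ)| := by
    calc |(U : ℝ) - V * Real.sqrt 2| ≤ |(U : ℝ)| + |(V : ℝ) * Real.sqrt 2| := abs_sub _ _
      _ = |(U : ℝ)| + |(V : ℝ)| * Real.sqrt 2 := by rw [abs_mul, abs_of_pos hs0]
      _ ≤ |(U : ℝ)| + 2 * |(V : ℝ)| := by nlinarith [abs_nonneg (V : ℝ)]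
  have hApos : (0 : ℝ) < |(U : ℝ)| + 2 * |(V : ℝ)| := by
    by_cases hU : (U : ℝ) = 0
    · have hV : (V : ℝ) ≠ 0 := by
        intro hV; rw [hU, hV] at h; simp at h
      have := abs_pos.2 hV
      have := abs_nonneg (U : ℝ)
      linarith
    · have := abs_pos.2 hU
      have := abs_nonneg (V : ℝ)
      linarith
  -- `(U + V√2) · |U − V√2| = |Δ| ≥ 1`
  have hprod : ((U : ℝ) + V * Real.sqrt 2) * |(U : ℝ) - V * Real.sqrt 2| = |(U : ℝ) ^ 2 - 2 * (V : ℝ) ^ 2| := by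
    rw [← abs_of_pos h, ← abs_mul]
    congr 1; nlinarith [hsq]
  rw [div_le_iff₀ hApos]
  calc (1 : ℝ) ≤ |(U : ℝ) ^ 2 - 2 * (V : ℝ) ^ 2| := hΔ1
    _ = ((U : ℝ) + V * Real.sqrt 2) * |(U : ℝ) - V * Real.sqrt 2| := hprod.symm
    _ ≤ ((U : ℝ) + V * Real.sqrt 2) * (|(U : ℝ)| + 2 * |(V : ℝ)|) := mul_le_mul_of_nonneg_left hB h.le

/-! ### The output: a dyadic rational close to `ξ` -/

/-- The integer approximation `s ≈ V 2^K √2` by an integer square root: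
`s = ± ⌊√(2 V² 4^K)⌋`. [folklore] -/
def sqrtTerm (V : ℤ) (K : ℕ) : ℤ :=
  if 0 ≤ V then (Nat.sqrt (2 * V.natAbs ^ 2 * 4 ^ K) : ℤ) else -(Nat.sqrt (2 * V.natAbs ^ 2 * 4 ^ K) : ℤ)

/-- `|s − V 2^K √2| ≤ 1`. [folklore] -/
theorem abs_sqrtTerm_sub_le (V : ℤ) (K : ℕ) :
    |(sqrtTerm V K : ℝ) - V * 2 ^ K * Real.sqrt 2| ≤ 1 := by
  set m : ℕ := 2 * V.natAbs ^ 2 * 4 ^ K with hm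
  set s : ℕ := Nat.sqrt m with hs
  have hx : ((V.natAbs : ℝ) * 2 ^ K * Real.sqrt 2) ^ 2 = (m : ℝ) := by
    rw [hm]; push_cast
    rw [mul_pow, mul_pow, Real.sq_sqrt (by norm_num), ← pow_mul, show (4 : ℝ) = 2 ^ 2 by norm_num, ← pow_mul]
    ring
  have hxnn : 0 ≤ (V.natAbs : ℝ) * 2 ^ K * Real.sqrt 2 := by positivity
  -- `s ≤ x < s + 1` for `x = |V| 2^K √2`
  have hlow : (s : ℝ) ≤ (V.natAbs : ℝ) * 2 ^ K * Real.sqrt 2 := by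
    apply le_of_sq_le_sq _ hxnn
    rw [hx]; exact_mod_cast Nat.sqrt_le' m
  have hup : (V.natAbs : ℝ) * 2 ^ K * Real.sqrt 2 < s + 1 := by
    apply lt_of_pow_lt_pow_left₀ 2 (by positivity)
    rw [hx]; exact_mod_cast Nat.lt_succ_sqrt' m
  have hVabs : (V.natAbs : ℝ) = |(V : ℝ)| := by rw [Nat.cast_natAbs, Int.cast_abs]
  unfold sqrtTerm
  split
  · rename_i hV
    have hVc : (V : ℝ) = (V.natAbs : ℝ) := by
      rw [hVabs, abs_of_nonneg (by exact_mod_cast hV)]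
    rw [hVc, abs_le]
    push_cast
    constructor <;> linarith
  · rename_i hV
    have hVc : (V : ℝ) = -(V.natAbs : ℝ) := by
      rw [hVabs, abs_of_neg (by exact_mod_cast (not_le.1 hV)), neg_neg]
    rw [hVc, abs_le]
    push_cast
    constructor <;> linarith

/-- The precision: enough bits to beat `(|U| + 2|V| + 1) · D · 2^{q+5}`. [folklore] -/
def precK (U V : ℤ) (D q : ℕ) : ℕ := Nat.size (U.natAbs + 2 * V.natAbs + 1) + Nat.size D + q + 5

/-- **The output of the estimator** from the sample totals `U, V`, the denominator
`D = L 2^h 4^{1+⌈t/2⌉}` and the precision parameter `q`: `0` if `U = V = 0`, else the reduced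
dyadic fraction `(2c+1)/2^{K+1}` with `c = ⌊(U 2^K + s)₊ / D⌋`.
[cite: BravyiGosset2016, p. 2 ("outputs a real number ξ …")] -/
def finalize (U V : ℤ) (D q : ℕ) : ℚ :=
  if U = 0 ∧ V = 0 then 0 else
    let K := precK U V D q
    let c : ℕ := (U * 2 ^ K + sqrtTerm V K).toNat / D
    (2 * c + 1 : ℚ) / 2 ^ (K + 1)

/-- `5 (q+1) ≤ 16 · 2^q`. [folklore] -/
theorem five_mul_succ_le (q : ℕ) : 5 * (q + 1) ≤ 16 * 2 ^ q := by
  induction q with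
  | zero => norm_num
  | succ q ih => rw [pow_succ]; omega

/-- **The output is relatively close to `ξ`.** If `ξ = (U + V√2)/D > 0` (`D ≥ 1`) then
`|finalize − ξ| ≤ ξ / (4 (q+1))`. [cite: BravyiGosset2016, p. 2 eq. (2)] -/
theorem finalize_close (U V : ℤ) (D q : ℕ) (hD : 0 < D) (hξ : 0 < ((U : ℝ) + V * Real.sqrt 2) / D) :
    |(finalize U V D q : ℝ) - ((U : ℝ) + V * Real.sqrt 2) / D| ≤
      ((U : ℝ) + V * Real.sqrt 2) / D / (4 * (q + 1)) := by
  have hDr : (0 : ℝ) < D := by exact_mod_cast hD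
  have hpos : 0 < (U : ℝ) + V * Real.sqrt 2 := by
    have := mul_pos hξ hDr; rwa [div_mul_cancel₀ _ hDr.ne'] at this
  have hne : ¬ (U = 0 ∧ V = 0) := by
    rintro ⟨rfl, rfl⟩; simp at hpos
  unfold finalize
  rw [if_neg hne]
  set K := precK U V D q with hK
  set W : ℤ := U * 2 ^ K + sqrtTerm V K with hW
  set c : ℕ := W.toNat / D with hc
  set ξ : ℝ := ((U : ℝ) + V * Real.sqrt 2) / D with hξdef
  -- (1) `|W − 2^K (U + V√2)| ≤ 1`
  have hW1 : |(W : ℝ) - 2 ^ K * ((U : ℝ) + V * Real.sqrt 2)| ≤ 1 := by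
    have := abs_sqrtTerm_sub_le V K
    rw [hW]; push_cast
    calc |(U : ℝ) * 2 ^ K + (sqrtTerm V K : ℝ) - 2 ^ K * ((U : ℝ) + V * Real.sqrt 2)|
        = |(sqrtTerm V K : ℝ) - V * 2 ^ K * Real.sqrt 2| := by congr 1; ring
      _ ≤ 1 := this
  -- (2) `|c − 2^K ξ| ≤ 2`
  have hc2 : |(c : ℝ) - 2 ^ K * ξ| ≤ 2 := by
    have hWD : |(W : ℝ) / D - 2 ^ K * ξ| ≤ 1 := by
      rw [hξdef, show (2 : ℝ) ^ K * (((U : ℝ) + V * Real.sqrt 2) / D) = 2 ^ K * ((U : ℝ) + V * Real.sqrt 2) / D by ring,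
        ← sub_div, abs_div, abs_of_pos hDr, div_le_iff₀ hDr]
      calc _ ≤ (1 : ℝ) := hW1
        _ ≤ 1 * D := by rw [one_mul]; exact_mod_cast hD
    by_cases hW0 : 0 ≤ W
    · -- `c = ⌊W/D⌋`
      have hcW : (c : ℝ) ≤ (W : ℝ) / D ∧ (W : ℝ) / D < c + 1 := by
        have hWn : (W.toNat : ℤ) = W := Int.toNat_of_nonneg hW0
        have hWr : (W : ℝ) = (W.toNat : ℝ) := by exact_mod_cast hWn.symm
        rw [hWr, le_div_iff₀ hDr, div_lt_iff₀ hDr]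
        constructor
        · exact_mod_cast Nat.div_mul_le_self W.toNat D
        · have := Nat.lt_div_mul_add (a := W.toNat) hD
          rw [← hc] at this
          calc (W.toNat : ℝ) < (c * D + D : ℕ) := by exact_mod_cast this
            _ = ((c : ℝ) + 1) * D := by push_cast; ring
      rw [abs_le] at hWD ⊢
      constructor <;> linarith [hcW.1, hcW.2]
    · -- `W < 0`: `c = 0` and `2^K ξ < 1`
      have hc0 : c = 0 := by rw [hc, Int.toNat_eq_zero.2 (by omega), Nat.zero_div]
      have hWneg : (W : ℝ) / D < 0 := div_neg_of_neg_of_pos (by exact_mod_cast (not_le.1 hW0)) hDr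
      have hξK : 0 < 2 ^ K * ξ := by positivity
      rw [hc0, abs_le] at *
      push_cast
      constructor <;> linarith [hWD.1, hWD.2]
  -- (3) `|p̂ − ξ| ≤ 5 / 2^{K+1}`
  have hK0 : (0 : ℝ) < 2 ^ K := by positivity
  have hp : |(((2 * (c : ℚ) + 1) / 2 ^ (K + 1) : ℚ) : ℝ) - ξ| ≤ 5 / 2 ^ (K + 1) := by
    push_cast
    rw [show ((2 : ℝ) * c + 1) / 2 ^ (K + 1) - ξ = ((c : ℝ) - 2 ^ K * ξ + 1 / 2) / 2 ^ K by
      rw [pow_succ]; field_simp; ring]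
    rw [abs_div, abs_of_pos hK0, div_le_div_iff₀ hK0 (by positivity), pow_succ]
    have : |(c : ℝ) - 2 ^ K * ξ + 1 / 2| ≤ 5 / 2 := by
      calc _ ≤ |(c : ℝ) - 2 ^ K * ξ| + |(1 / 2 : ℝ)| := abs_add_le _ _
        _ ≤ 2 + 1 / 2 := by rw [abs_of_pos (by norm_num : (0:ℝ) < 1 / 2)]; linarith
        _ = 5 / 2 := by norm_num
    nlinarith
  -- (4) `5 / 2^{K+1} ≤ ξ / (4(q+1))`
  have hA : 1 / (|(U : ℝ)| + 2 * |(V : ℝ)|) ≤ (U : ℝ) + V * Real.sqrt 2 := inv_le_add_mul_sqrt_two hpos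
  set A : ℕ := U.natAbs + 2 * V.natAbs with hAdef
  have hAr : (|(U : ℝ)| + 2 * |(V : ℝ)|) = (A : ℝ) := by
    rw [hAdef]; push_cast; rw [Nat.cast_natAbs, Nat.cast_natAbs]; push_cast; ring
  have hApos : (0 : ℝ) < A := by
    rw [← hAr]
    by_cases hU : (U : ℝ) = 0
    · have hV : (V : ℝ) ≠ 0 := by
        intro hV; rw [hU, hV] at hpos; simp at hpos
      have := abs_pos.2 hV
      have := abs_nonneg (U : ℝ)
      linarith
    · have := abs_pos.2 hU
      have := abs_nonneg (V : ℝ)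
      linarith
  have h2K : (64 : ℝ) * A * D * 2 ^ q ≤ 2 ^ (K + 1) := by
    have h1 : (A : ℝ) + 1 < 2 ^ Nat.size (A + 1) := by exact_mod_cast Nat.lt_size_self (A + 1)
    have h2 : (D : ℝ) < 2 ^ Nat.size D := by exact_mod_cast Nat.lt_size_self D
    have hKe : (2 : ℝ) ^ (K + 1) = 2 ^ Nat.size (A + 1) * 2 ^ Nat.size D * 2 ^ q * 2 ^ 6 := by
      rw [hK, precK, ← hAdef, ← pow_add, ← pow_add, ← pow_add]
    rw [hKe]
    have hA1 : (A : ℝ) ≤ 2 ^ Nat.size (A + 1) := by linarith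
    have : (A : ℝ) * D ≤ 2 ^ Nat.size (A + 1) * 2 ^ Nat.size D :=
      mul_le_mul hA1 h2.le hDr.le (by positivity)
    nlinarith [pow_pos (show (0:ℝ) < 2 by norm_num) q]
  have hξA : 1 / ((A : ℝ) * D) ≤ ξ := by
    rw [hξdef, ← hAr, one_div, mul_inv, ← one_div, ← one_div, ← div_eq_mul_one_div]
    exact div_le_div_of_nonneg_right hA hDr.le
  have hq5 : (5 : ℝ) * (q + 1) ≤ 16 * 2 ^ q := by exact_mod_cast five_mul_succ_le q
  have hfin : 5 / (2 : ℝ) ^ (K + 1) ≤ ξ / (4 * (q + 1)) := by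
    have hq1 : (0 : ℝ) < 4 * (q + 1) := by positivity
    rw [div_le_div_iff₀ (by positivity) hq1]
    -- `5 · 4(q+1) ≤ ξ · 2^{K+1}`, via `ξ ≥ 1/(A D)` and `2^{K+1} ≥ 64 A D 2^q`
    have hAD : (0 : ℝ) < (A : ℝ) * D := by positivity
    have hξ2 : (64 : ℝ) * 2 ^ q / ((A : ℝ) * D) * ((A : ℝ) * D) ≤ ξ * 2 ^ (K + 1) := by
      calc (64 : ℝ) * 2 ^ q / ((A : ℝ) * D) * ((A : ℝ) * D) = 64 * 2 ^ q := div_mul_cancel₀ _ hAD.ne'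
        _ = 1 / ((A : ℝ) * D) * (64 * A * D * 2 ^ q) := by field_simp
        _ ≤ ξ * 2 ^ (K + 1) := mul_le_mul hξA h2K (by positivity) (le_trans (by positivity) hξA)
    rw [div_mul_cancel₀ _ hAD.ne'] at hξ2
    nlinarith [pow_pos (show (0:ℝ) < 2 by norm_num) q]
  show |(((2 * (c : ℚ) + 1) / 2 ^ (K + 1) : ℚ) : ℝ) - ξ| ≤ ξ / (4 * (q + 1))
  exact hp.trans hfin

/-- The output `0` in the degenerate case. [folklore] -/
theorem finalize_zero (D q : ℕ) : finalize 0 0 D q = 0 := by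
  unfold finalize; simp

/-! ### The estimator on an instance -/

/-- The number of samples `L = 16 (q+1)²` (`= 4 (ε/2)⁻²` for the target relative error
`ε = 1/(q+1)`, spent as `ε/2` on sampling and the rest on rounding).
[cite: BravyiGosset2016, §II eq. (16) (`L = 4ε⁻²`)] -/
def numSamples (q : ℕ) : ℕ := 16 * (q + 1) ^ 2

/-- The final symbolic state of an instance: the circuit run symbolically on `|x 0^m⟩`.
[folklore] -/
def finalState (i : CliffordTInstance) : SymState :=
  SymState.execGates i.circ.gates (SymState.init (padInput i.x i.m))

/-- The sample totals `(U, V)` of an instance on a tuple of sample blocks.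
[cite: BravyiGosset2016, §II eq. (15)] -/
def totals (i : CliffordTInstance) (ω : Fin (numSamples i.q) → (Fin (blockLen (i.n + i.m)) → Bool)) : ℤ × ℤ :=
  let σ := finalState i
  (∑ l, uOf (sampleEO (i.n + i.m) σ.nv (wbit (ω l)) σ), ∑ l, vOf (sampleEO (i.n + i.m) σ.nv (wbit (ω l)) σ))

/-- The denominator `D = L · 2^h · 4^{1+⌈t/2⌉}`. [folklore] -/
def denom (i : CliffordTInstance) : ℕ :=
  numSamples i.q * 2 ^ hCount i.circ.gates * 4 ^ ((finalState i).numA + 1)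

/-- The estimate from a tuple of sample blocks. [cite: BravyiGosset2016, p. 2 and §II] -/
def estimateBlocks (i : CliffordTInstance) (ω : Fin (numSamples i.q) → (Fin (blockLen (i.n + i.m)) → Bool)) : ℚ :=
  finalize (totals i ω).1 (totals i ω).2 (denom i) i.q

/-- **The Bravyi–Gosset estimate** of the acceptance probability of an instance from a coin string
(the first `L · (N² + 2N)` coins, in `L` blocks). [cite: BravyiGosset2016, p. 2 eq. (2) and §II] -/
def estimate (i : CliffordTInstance) (r : List Bool) : ℚ :=
  estimateBlocks i (blocksOf (blockLen (i.n + i.m)) r (numSamples i.q))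

/-- The coin budget as a function of the input length `ℓ`: `16 (ℓ+1)² (ℓ² + 2ℓ) ≥ L (N² + 2N)`.
[folklore] -/
def coinLen (ℓ : ℕ) : ℕ := numSamples ℓ * blockLen ℓ

/-- **The randomized algorithm** of the named fact. [cite: BravyiGosset2016, p. 2 eq. (2)] -/
def randAlg : RandAlg CliffordTInstance ℚ := ⟨estimate, coinLen⟩

/-! ### Input-length bookkeeping -/

/-- The wires, the precision and the size are below the input length. [folklore] -/
theorem params_le_length_encode (i : CliffordTInstance) :
    i.n + i.m + i.q + i.circ.size ≤ (CliffordTInstance.encode i).length := by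
  have h1 := QCircuit.size_add_le_length_sigmaEncode (G := cliffordT) i.n i.m i.circ
  unfold CliffordTInstance.encode
  rw [length_boolPair, length_boolPair, List.length_ofFn, show (unaryEncodeNat i.q).length = i.q from
    unary_decode_encode_nat i.q]
  omega

/-- `numSamples` is monotone. [folklore] -/
theorem numSamples_mono {a b : ℕ} (h : a ≤ b) : numSamples a ≤ numSamples b := by
  unfold numSamples; gcongr

/-- `blockLen` is monotone. [folklore] -/
theorem blockLen_mono {a b : ℕ} (h : a ≤ b) : blockLen a ≤ blockLen b := by
  unfold blockLen; gcongr

/-- **The coin budget covers the samples**: `L · (N² + 2N) ≤ coinLen |encode i|`. [folklore] -/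
theorem samples_le_coinLen (i : CliffordTInstance) :
    numSamples i.q * blockLen (i.n + i.m) ≤ coinLen (CliffordTInstance.encode i).length := by
  have h := params_le_length_encode i
  unfold coinLen
  exact Nat.mul_le_mul (numSamples_mono (by omega)) (blockLen_mono (by omega))

/-! ### The estimate only reads the sample coins -/

/-- The blocks of a string are the blocks of its prefix of length `L κ`. [folklore] -/
theorem blocksOf_take (κ L : ℕ) (r : List Bool) : blocksOf κ (r.take (L * κ)) L = blocksOf κ r L := by
  funext l q
  unfold blocksOf
  have hlt : (l : ℕ) * κ + q < L * κ := by
    have := l.2; have := q.2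
    calc (l : ℕ) * κ + q < l * κ + κ := by omega
      _ = (l + 1) * κ := by ring
      _ ≤ L * κ := Nat.mul_le_mul_right κ l.2
  rw [List.getD_eq_getElem?_getD, List.getElem?_take_of_lt hlt, ← List.getD_eq_getElem?_getD]

/-! ### The acceptance probability as the norm of `Φ` -/

/-- The projected output amplitudes `Φ(z) = [z₀ = 1] · ⟨z| U |x 0^m⟩` of an instance with `N ≥ 1`
wires. [cite: BravyiGosset2016, eq. (1)] -/
def Phi (i : CliffordTInstance) (hN : 0 < i.n + i.m) : QReg (i.n + i.m) → ℂ :=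
  fun z => if z ⟨0, hN⟩ then (prodZeta omega i.circ.gates *ᵥ basisState (padInput i.x i.m)) z else 0

/-- The one-sample statistic `X(β) = |T_β(Φ)|²`. [cite: BravyiGosset2016, §II eq. (15)] -/
def Xstat (i : CliffordTInstance) (hN : 0 < i.n + i.m) (β : Fin (blockLen (i.n + i.m)) → Bool) : ℝ :=
  Complex.normSq (testSum (Phi i hN) β)

/-- For an oracle-free instance with `N ≥ 1` wires, the acceptance probability is `Σ_z |Φ(z)|²`.
[folklore] -/
theorem acceptProb_eq_sum_normSq (i : CliffordTInstance) (hi : i.circ.IsOracleFree) (hN : 0 < i.n + i.m) :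
    i.acceptProb = ∑ z : QReg (i.n + i.m), Complex.normSq (Phi i hN z) := by
  unfold CliffordTInstance.acceptProb QCircuit.acceptProb QCircuit.runOn Phi
  rw [← prodZeta_omega 0 hi]
  refine Finset.sum_congr rfl fun z _ => ?_
  rw [dif_pos hN]
  by_cases hz : z ⟨0, hN⟩ = true
  · rw [if_pos hz, if_pos hz, Complex.normSq_eq_norm_sq]
  · rw [if_neg hz, if_neg hz, map_zero]

/-- **The sample totals in terms of the statistics**: `U + V√2 = 2^h 4^{1+⌈t/2⌉} Σ_l X(ω_l)`.
[cite: BravyiGosset2016, §II eq. (15)] -/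
theorem totals_real_eq (i : CliffordTInstance) (hi : i.circ.IsOracleFree) (hN : 0 < i.n + i.m)
    (ω : Fin (numSamples i.q) → (Fin (blockLen (i.n + i.m)) → Bool)) :
    ((totals i ω).1 : ℝ) + (totals i ω).2 * Real.sqrt 2 =
      2 ^ hCount i.circ.gates * 4 ^ ((finalState i).numA + 1) * ∑ l, Xstat i hN (ω l) := by
  have hgs : ∀ g ∈ i.circ.gates, g.IsOracleFree := hi
  unfold totals Xstat
  simp only
  push_cast
  rw [Finset.sum_mul, ← Finset.sum_add_distrib, Finset.mul_sum]
  exact Finset.sum_congr rfl fun l _ => uv_sampleEO_eq hN i.circ.gates hgs (padInput i.x i.m) (ω l)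

/-! ### The guarantee -/

/-- The probability of an event under `randAlg` is a `uniformProb` over the coin strings.
[cite: AroraBarakCC2009, §7.1] -/
theorem pr_eq_uniformProb (i : CliffordTInstance) (E : Set ℚ) :
    randAlg.pr CliffordTInstance.encode i E =
      uniformProb (coinLen (CliffordTInstance.encode i).length) {r | estimate i r ∈ E} := by
  rw [uniformProb_eq_toOuterMeasure, RandAlg.pr, RandAlg.outputPMF, PMF.toOuterMeasure_map_apply]
  rfl

/-- **In the degenerate cases the estimate is exact.** If `P = 0` (in particular if `N = 0`) then
every tuple of blocks gives the totals `U = V = 0`. [folklore] -/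
theorem totals_eq_zero_of_acceptProb_eq_zero (i : CliffordTInstance) (hi : i.circ.IsOracleFree)
    (hP : i.acceptProb = 0) (ω : Fin (numSamples i.q) → (Fin (blockLen (i.n + i.m)) → Bool)) :
    totals i ω = (0, 0) := by
  have hgs : ∀ g ∈ i.circ.gates, g.IsOracleFree := hi
  -- every sample has `E + ωO = 0`
  have hzero : ∀ l, ((sampleEO (i.n + i.m) (finalState i).nv (wbit (ω l)) (finalState i)).1 : ℂ) +
      omega * ((sampleEO (i.n + i.m) (finalState i).nv (wbit (ω l)) (finalState i)).2 : ℂ) = 0 := by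
    intro l
    rcases Nat.eq_zero_or_pos (i.n + i.m) with hN | hN
    · -- no wires: the output form is the constant `0`, every term vanishes
      rw [toComplex_sampleEO]
      refine Finset.sum_eq_zero fun a _ => ?_
      have hσs : (finalState i).Supp := (SymState.supp_init _).exec _
      rw [SymState.gsum_buildData _ _ (finalState i) hσs]
      have hform : (finalState i).form 0 = AffForm.const false := by
        have hlen : (finalState i).forms.length = 0 := by
          rw [finalState, SymState.execGates, SymState.length_forms_exec, SymState.length_forms_init, hN]
        unfold SymState.form
        exact List.getD_eq_default _ _ (by rw [hlen])
      simp [hform]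
    · have h := invSqrt2_pow_mul_sampleEO hN i.circ.gates hgs (padInput i.x i.m) (ω l)
      have hΦ : ∀ z, Phi i hN z = 0 := by
        have hsum := acceptProb_eq_sum_normSq i hi hN
        rw [hP] at hsum
        have := (Finset.sum_eq_zero_iff_of_nonneg (fun z _ => Complex.normSq_nonneg _)).1 hsum.symm
        intro z
        exact Complex.normSq_eq_zero.1 (this z (Finset.mem_univ z))
      have hT : testSum (Phi i hN) (ω l) = 0 := by
        unfold testSum; exact Finset.sum_eq_zero fun z _ => by rw [hΦ z, mul_zero]
      have hT' : testSum (fun z : QReg (i.n + i.m) => if z ⟨0, hN⟩ then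
          (prodZeta omega i.circ.gates *ᵥ basisState (padInput i.x i.m)) z else 0) (ω l) = 0 := hT
      simp only [hT', mul_zero, mul_eq_zero] at h
      rcases h with h | h
      · exact absurd h (pow_ne_zero _ (by simp [invSqrt2]))
      · exact h
  have huv : ∀ l, uOf (sampleEO (i.n + i.m) (finalState i).nv (wbit (ω l)) (finalState i)) = 0 ∧
      vOf (sampleEO (i.n + i.m) (finalState i).nv (wbit (ω l)) (finalState i)) = 0 := by
    intro l
    apply eq_zero_of_add_mul_sqrt_two_eq_zero
    rw [← normSq_eq_uOf_add_vOf, hzero l, map_zero]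
  unfold totals
  simp only [huv, Finset.sum_const_zero]

/-- **On a good tuple of blocks the estimate is good.** If `P > 0` and the sample sum deviates from
`L P` by less than `L P / (2(q+1))`, the output is within relative error `1/(q+1)` of `P`.
[cite: BravyiGosset2016, §II eq. (16)] -/
theorem estimateBlocks_mem_goodEstimates (i : CliffordTInstance) (hi : i.circ.IsOracleFree)
    (hN : 0 < i.n + i.m) (hP : 0 < i.acceptProb)
    (ω : Fin (numSamples i.q) → (Fin (blockLen (i.n + i.m)) → Bool))
    (hdev : |∑ l, Xstat i hN (ω l) - (numSamples i.q : ℕ) * i.acceptProb| <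
      (numSamples i.q : ℕ) * i.acceptProb / (2 * (i.q + 1))) :
    estimateBlocks i ω ∈ i.goodEstimates := by
  have hLpos : (0 : ℝ) < (numSamples i.q : ℕ) := by unfold numSamples; positivity
  have hDpos : 0 < denom i := by unfold denom numSamples; positivity
  have hDr : (denom i : ℝ) = (numSamples i.q : ℕ) * (2 ^ hCount i.circ.gates * 4 ^ ((finalState i).numA + 1)) := by
    unfold denom; push_cast; ring
  -- `ξ = Y / L`
  have hξY : (((totals i ω).1 : ℝ) + (totals i ω).2 * Real.sqrt 2) / denom i =
      (∑ l, Xstat i hN (ω l)) / (numSamples i.q : ℕ) := by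
    rw [totals_real_eq i hi hN ω, hDr]
    field_simp
  -- `|ξ − P| < P/(2(q+1))`
  have hξP : |(((totals i ω).1 : ℝ) + (totals i ω).2 * Real.sqrt 2) / denom i - i.acceptProb| <
      i.acceptProb / (2 * (i.q + 1)) := by
    rw [hξY]
    have heq : (∑ l, Xstat i hN (ω l)) / (numSamples i.q : ℕ) - i.acceptProb =
        ((∑ l, Xstat i hN (ω l)) - (numSamples i.q : ℕ) * i.acceptProb) / (numSamples i.q : ℕ) := by
      field_simp
    rw [heq, abs_div, abs_of_pos hLpos, div_lt_iff₀ hLpos]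
    calc _ < (numSamples i.q : ℕ) * i.acceptProb / (2 * (i.q + 1)) := hdev
      _ = i.acceptProb / (2 * (i.q + 1)) * (numSamples i.q : ℕ) := by ring
  have hξpos : 0 < (((totals i ω).1 : ℝ) + (totals i ω).2 * Real.sqrt 2) / denom i := by
    have h1 := (abs_lt.1 hξP).1
    have h2 : i.acceptProb / (2 * (i.q + 1)) ≤ i.acceptProb / 2 :=
      div_le_div_of_nonneg_left hP.le (by norm_num) (by
        have : (0:ℝ) ≤ i.q := Nat.cast_nonneg _
        linarith)
    linarith
  have hclose := finalize_close (totals i ω).1 (totals i ω).2 (denom i) i.q hDpos hξpos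
  have hξle : (((totals i ω).1 : ℝ) + (totals i ω).2 * Real.sqrt 2) / denom i ≤ 3 / 2 * i.acceptProb := by
    have h1 := (abs_lt.1 hξP).2
    have h2 : i.acceptProb / (2 * (i.q + 1)) ≤ i.acceptProb / 2 :=
      div_le_div_of_nonneg_left hP.le (by norm_num) (by
        have : (0:ℝ) ≤ i.q := Nat.cast_nonneg _
        linarith)
    linarith
  -- assemble
  show |(estimateBlocks i ω : ℝ) - i.acceptProb| ≤ i.acceptProb / (i.q + 1)
  unfold estimateBlocks
  have hq1 : (0 : ℝ) < i.q + 1 := by positivity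
  calc |(finalize (totals i ω).1 (totals i ω).2 (denom i) i.q : ℝ) - i.acceptProb|
      ≤ |(finalize (totals i ω).1 (totals i ω).2 (denom i) i.q : ℝ) -
          (((totals i ω).1 : ℝ) + (totals i ω).2 * Real.sqrt 2) / denom i| +
        |(((totals i ω).1 : ℝ) + (totals i ω).2 * Real.sqrt 2) / denom i - i.acceptProb| := abs_sub_le _ _ _
    _ ≤ (((totals i ω).1 : ℝ) + (totals i ω).2 * Real.sqrt 2) / denom i / (4 * (i.q + 1)) +
        i.acceptProb / (2 * (i.q + 1)) := add_le_add hclose hξP.le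
    _ ≤ (3 / 2 * i.acceptProb) / (4 * (i.q + 1)) + i.acceptProb / (2 * (i.q + 1)) := by gcongr
    _ = (7 / 8) * (i.acceptProb / (i.q + 1)) := by field_simp; ring
    _ ≤ i.acceptProb / (i.q + 1) := by
        have : 0 ≤ i.acceptProb / (i.q + 1) := div_nonneg hP.le hq1.le
        linarith

/-- The deviation event of Chebyshev's inequality on block tuples. [folklore] -/
def Deviates (i : CliffordTInstance) (hN : 0 < i.n + i.m)
    (ω : Fin (numSamples i.q) → (Fin (blockLen (i.n + i.m)) → Bool)) : Prop :=
  (numSamples i.q : ℕ) * i.acceptProb / (2 * (i.q + 1)) ≤ |∑ l, Xstat i hN (ω l) - (numSamples i.q : ℕ) * i.acceptProb|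

open scoped Classical in
/-- **At most a quarter of the block tuples are bad.** [cite: BravyiGosset2016, §II eq. (16)] -/
theorem four_mul_card_bad_le (i : CliffordTInstance) (hi : i.circ.IsOracleFree) :
    4 * ((Finset.univ.filter fun ω : Fin (numSamples i.q) → (Fin (blockLen (i.n + i.m)) → Bool) =>
        estimateBlocks i ω ∉ i.goodEstimates).card : ℝ) ≤ 2 ^ (blockLen (i.n + i.m) * numSamples i.q) := by
  classical
  rcases (QCircuit.acceptProb_nonneg 0 i.circ i.x).lt_or_eq with hP | hP
  · -- `P > 0`: Chebyshev
    have hP' : 0 < i.acceptProb := hP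
    have hN : 0 < i.n + i.m := by
      by_contra h0
      have : i.acceptProb = 0 := by
        unfold CliffordTInstance.acceptProb QCircuit.acceptProb
        exact Finset.sum_eq_zero fun z _ => by rw [dif_neg h0]
      exact hP'.ne' this
    have hPsum : i.acceptProb = ∑ z, Complex.normSq (Phi i hN z) := acceptProb_eq_sum_normSq i hi hN
    have hmean : ∑ β, Xstat i hN β = 2 ^ blockLen (i.n + i.m) * i.acceptProb := by
      rw [hPsum]; exact sum_normSq_testSum (Phi i hN)
    have hsq : ∑ β, Xstat i hN β ^ 2 ≤ 2 ^ blockLen (i.n + i.m) * (2 * i.acceptProb ^ 2) := by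
      rw [hPsum]; exact sum_normSq_sq_testSum_le (Phi i hN)
    have hcheb := card_deviation_le_quarter i.q (Xstat i hN) i.acceptProb hP' hmean hsq
    refine le_trans ?_ hcheb
    have hsub : (Finset.univ.filter fun ω : Fin (numSamples i.q) → (Fin (blockLen (i.n + i.m)) → Bool) =>
        estimateBlocks i ω ∉ i.goodEstimates) ⊆ Finset.univ.filter (Deviates i hN) := by
      intro ω hω
      rw [Finset.mem_filter] at hω ⊢
      refine ⟨Finset.mem_univ _, ?_⟩
      by_contra hnd
      exact hω.2 (estimateBlocks_mem_goodEstimates i hi hN hP' ω (not_le.1 hnd))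
    have hcard := Finset.card_le_card hsub
    have hcast : ((Finset.univ.filter fun ω : Fin (numSamples i.q) → (Fin (blockLen (i.n + i.m)) → Bool) =>
        estimateBlocks i ω ∉ i.goodEstimates).card : ℝ) ≤ (Finset.univ.filter (Deviates i hN)).card := by
      exact_mod_cast hcard
    have : 4 * ((Finset.univ.filter (Deviates i hN)).card : ℝ) ≤ 4 * ((Finset.univ.filter
        fun ω : Fin (16 * (i.q + 1) ^ 2) → (Fin (blockLen (i.n + i.m)) → Bool) =>
          (16 * (i.q + 1) ^ 2 : ℕ) * i.acceptProb / (2 * (i.q + 1)) ≤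
            |∑ l, Xstat i hN (ω l) - (16 * (i.q + 1) ^ 2 : ℕ) * i.acceptProb|).card : ℝ) := le_of_eq rfl
    linarith
  · -- `P = 0`: no bad tuple
    have hnone : (Finset.univ.filter fun ω : Fin (numSamples i.q) → (Fin (blockLen (i.n + i.m)) → Bool) =>
        estimateBlocks i ω ∉ i.goodEstimates) = ∅ := by
      refine Finset.filter_eq_empty_iff.2 fun ω _ hω => hω ?_
      unfold estimateBlocks
      rw [totals_eq_zero_of_acceptProb_eq_zero i hi hP.symm ω]
      show finalize 0 0 (denom i) i.q ∈ i.goodEstimates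
      rw [finalize_zero]
      exact CliffordTInstance.mem_goodEstimates_of_eq i (by push_cast; exact hP)
    rw [hnone, Finset.card_empty]
    simp
set_option maxHeartbeats 400000 in -- buildfix (bf3-g27): 160k/180k FAIL, 200k PASS at accept time; line-neutral budget line
/-- **Bravyi–Gosset's success probability.** For every oracle-free instance, the estimate lies
within relative error `1/(q+1)` of the acceptance probability with probability at least `3/4`
over the coins. [cite: BravyiGosset2016, p. 2 eq. (2) and §II eq. (16)] -/
theorem pr_goodEstimates_ge (i : CliffordTInstance) (hi : i.circ.IsOracleFree) :
    (3 / 4 : ℝ) ≤ randAlg.pr CliffordTInstance.encode i i.goodEstimates := by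
  classical
  have hLκ : numSamples i.q * blockLen (i.n + i.m) ≤ coinLen (CliffordTInstance.encode i).length :=
    samples_le_coinLen i
  obtain ⟨d, hd⟩ : ∃ d, coinLen (CliffordTInstance.encode i).length = numSamples i.q * blockLen (i.n + i.m) + d :=
    ⟨_, (Nat.add_sub_cancel' hLκ).symm⟩
  -- the failure event as a set of coin strings, and its count
  have hevent : {r : List Bool | estimate i r ∈ i.goodEstimates}ᶜ =
      {r | estimateBlocks i (blocksOf (blockLen (i.n + i.m)) r (numSamples i.q)) ∉ i.goodEstimates} := by
    ext r; rfl
  have hcnt : cnt (coinLen (CliffordTInstance.encode i).length)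
      {r | estimateBlocks i (blocksOf (blockLen (i.n + i.m)) r (numSamples i.q)) ∉ i.goodEstimates} =
      (Finset.univ.filter fun ω : Fin (numSamples i.q) → (Fin (blockLen (i.n + i.m)) → Bool) =>
        estimateBlocks i ω ∉ i.goodEstimates).card * 2 ^ d := by
    rw [hd, cnt_congr (E' := {y | y.take (numSamples i.q * blockLen (i.n + i.m)) ∈
        {r : List Bool | estimateBlocks i (blocksOf (blockLen (i.n + i.m)) r (numSamples i.q)) ∉ i.goodEstimates} ∧
        y.drop (numSamples i.q * blockLen (i.n + i.m)) ∈ (Set.univ : Set (List Bool))})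
      (fun y _ => by simp only [Set.mem_setOf_eq, Set.mem_univ, and_true, blocksOf_take]),
      cnt_take_drop, cnt_univ, cnt_blocks (blockLen (i.n + i.m)) (numSamples i.q)
        (fun ω => estimateBlocks i ω ∉ i.goodEstimates)]
  have hcard := four_mul_card_bad_le i hi
  -- conclude
  rw [pr_eq_uniformProb, uniformProb_eq_cnt_div]
  have htot := cnt_add_cnt_compl (coinLen (CliffordTInstance.encode i).length)
    {r : List Bool | estimate i r ∈ i.goodEstimates}
  rw [hevent, hcnt] at htot
  have h2 : (2 : ℝ) ^ coinLen (CliffordTInstance.encode i).length = 2 ^ (blockLen (i.n + i.m) * numSamples i.q) * 2 ^ d := by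
    rw [← pow_add, hd, Nat.mul_comm]
  rw [le_div_iff₀ (pow_pos two_pos _), h2]
  have htot' : (cnt (coinLen (CliffordTInstance.encode i).length) {r : List Bool | estimate i r ∈ i.goodEstimates} : ℝ) +
      ((Finset.univ.filter fun ω : Fin (numSamples i.q) → (Fin (blockLen (i.n + i.m)) → Bool) =>
        estimateBlocks i ω ∉ i.goodEstimates).card : ℝ) * 2 ^ d =
      2 ^ (blockLen (i.n + i.m) * numSamples i.q) * 2 ^ d := by
    rw [← h2]; exact_mod_cast htot
  nlinarith [hcard, pow_pos (show (0:ℝ) < 2 by norm_num) d]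

end Literature.Computability.QuantumComplexity.BravyiGosset

end
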